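import Summits.QuantumFields.YangMills.Theorems.BalabanUVNodesN15KingModelGraphPowerCountingSparse

/-!
# BalabanUVNodes ∕ N15 — THE KING-MODEL RUNG (PART Δ-e): **A DECIDABLE SPARSITY CERTIFICATE FOR PROPOSITION 3.6, AND TWO EXPLICIT LOOP GRAPHS** — the integer
# form `(d−1)·|S| + d + 2 ≤ (d+1)·|V(S)|` of the sparsity condition (checked over ALL non-empty line sets, connectivity not needed) gives (3.56) for a connected
# graph of `G`-lines with no further hypothesis, and `decide` settles it for concrete graphs: the ONE-LOOP BUBBLE (two parallel lines) in King's three dimensions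
# (`d = 2`: degree `3·1 − 2 = 1 > 0`, nothing to renormalise) and the TWO-LOOP graph `K₄ − e` in four dimensions (`d = 3`)
# (Track A, DAG node N15 = NE2; FAN-OUT v1.1 §N15 s3 «KING-MODEL RUNG … NE2's analogue DECIDED in the model»)

HONEST FRAMING.  Count-neutral (cell `pub-ymgap`, seat `pub-ymgap-dag-n15-e` g28; `--supports stmt-QuantumFields-27366 --as helper` = K3⁸
`SpineGivenEndpointR13SepCoPHV`).  TEMPLATE LITERATURE: C. King, *The U(1) Higgs model. I. The continuum limit*, Commun. Math. Phys. **102** (1986) 649–677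
[King1986], Proposition 3.6 (3.56) p. 662, §3.4 p. 664.  Part Δ-d ★★★ `king_prop36_graph_zeroField_sparse` gives (3.56) outright for connected graphs of
`G`-lines whose non-empty connected sub-line-sets satisfy `((d+1) − 2)·|S| < (d+1)·(|V(S)| − 1)` (a real inequality quantified over connected sets).  THIS FILE
restates the hypothesis as a DECIDABLE natural-number inequality over all non-empty line sets — so that for an explicit numbered graph the whole of King's
subgraph condition is discharged by `decide` — and does so for two graphs with loops.  King's U(1)∕`A = 0` MODEL; NOT Bałaban's non-abelian `G(U)` of [B9]; NOT
a node discharge; nothing continuum ∕ ℝ⁴ ∕ OS ∕ mass-gap ∕ Clay.  0 `sorry`; standard axioms; `decide` only on graphs with `≤ 5` lines (no `native_decide`).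
THE PRINT.  p. 664 [PDF 16]: *«it is necessary that every subgraph have positive degree D … We will assume below that this has been done already»*.
WHAT THIS FILE PROVES.
* §1 (ns `…Graph`) ★ `sparse_of_sparseCert` (the integer certificate `∀ S ≠ ∅, (d−1)|S| + d + 2 ≤ (d+1)|V(S)|`, `1 ≤ d` ⇒ the real sparsity hypothesis of part
  Δ-d for every non-empty `S`, connected or not); the bubble `bubSrc`∕`bubTgt` (two lines `0 → 1`), `lConn_bubble`, `sparseCert_bubble_two` (`d = 2`, by `decide`);
  `K₄ − e`: `k4eSrc`∕`k4eTgt` (lines `01, 02, 03, 12, 13`), `lConn_k4e`, `sparseCert_k4e_three` (`d = 3`, by `decide`).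
* §2 (ns `…Curved`) ★★★ **`king_prop36_graph_zeroField_sparseCert`** ((3.56) for connected graphs of `G`-lines under the integer certificate, `1 ≤ d`), ★★
  **`king_prop36_graph_zeroField_bubble`** (the one-loop bubble, `d = 2` — King's three dimensions: a graph WITH A LOOP AND A PARALLEL PAIR obeying (3.56) outright),
  ★★ **`king_prop36_graph_zeroField_k4e`** (`K₄ − e`, two independent loops, `d = 3`).
HONEST SCOPE.  `G`-lines only; the certificate is SUFFICIENT (it ignores connectivity of `S`, harmlessly: the inequality is additive over components); King's
renormalised graphs (§3.5, [Ba3]) NOT typed; abstract one-vertex factors as in parts Γ∕Δ; NE2∕N15 of record untouched; counts unmoved.  Locators: [King1986]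
Prop. 3.6 (3.56) p.662, p.664.
-/
noncomputable section

namespace Summit.QuantumFields.YangMills.BalabanUVNodes.N15KingModelRung.Graph

open scoped BigOperators
open Finset

/-! ## §1 The integer certificate and two explicit graphs -/

section Cert
variable {nn m : ℕ}

/-- ★ **THE INTEGER SPARSITY CERTIFICATE GIVES THE REAL SPARSITY HYPOTHESIS OF PART Δ-d** (`1 ≤ d`): if every non-empty line set `S` has
`(d−1)·|S| + d + 2 ≤ (d+1)·|V(S)|` (natural numbers — decidable for explicit graphs), then `((d+1) − 2)·|S| < (d+1)·(|V(S)| − 1)` over `ℝ` for every non-empty `S`.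
[cite: King1986, p.664 («every subgraph have positive degree D»)] -/
theorem sparse_of_sparseCert {d : ℕ} (hd1 : 1 ≤ d) {src tgt : Fin m → Fin (nn + 1)}
    (h : ∀ S : Finset (Fin m), S.Nonempty → (d - 1) * S.card + d + 2 ≤ (d + 1) * (lineVerts src tgt S).card)
    (S : Finset (Fin m)) (hS : S.Nonempty) :
    (((d + 1 : ℕ) : ℝ) - 2) * (S.card : ℝ) < ((d + 1 : ℕ) : ℝ) * (((lineVerts src tgt S).card : ℝ) - 1) := by
  have h' := h S hS
  have hcast : (((d - 1 : ℕ) : ℝ)) = (d : ℝ) - 1 := by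
    rw [Nat.cast_sub hd1, Nat.cast_one]
  have h'' : ((d : ℝ) - 1) * (S.card : ℝ) + d + 2 ≤ ((d : ℝ) + 1) * ((lineVerts src tgt S).card : ℝ) := by
    rw [← hcast]; exact_mod_cast h'
  push_cast
  linarith

/-- the ONE-LOOP BUBBLE: two parallel lines `0 → 1` (external vertex `0`). [cite: King1986, p.664] -/
def bubSrc : Fin 2 → Fin 2 := ![0, 0]

/-- the bubble's targets. [cite: King1986, p.664] -/
def bubTgt : Fin 2 → Fin 2 := ![1, 1]

/-- the bubble is connected to its external vertex. [folklore] -/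
theorem lConn_bubble : ∀ v : Fin 2, LConn bubSrc bubTgt univ 0 v := by
  intro v
  fin_cases v
  · exact Relation.EqvGen.refl _
  · exact Relation.EqvGen.rel _ _ ⟨0, mem_univ _, rfl, rfl⟩

/-- **IN KING's THREE DIMENSIONS THE BUBBLE IS SPARSE** (`d = 2`: `|S| + 4 ≤ 3|V(S)|` for `S` = one line (`5 ≤ 6`) or both (`6 ≤ 6`) — degrees `2`, `1`). [cite: King1986, p.664] -/
theorem sparseCert_bubble_two :
    ∀ S : Finset (Fin 2), S.Nonempty → (2 - 1) * S.card + 2 + 2 ≤ (2 + 1) * (lineVerts bubSrc bubTgt S).card := by decide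

/-- `K₄ − e`: vertices `0, 1, 2, 3`, lines `01, 02, 03, 12, 13` (two independent loops). [cite: King1986, p.664] -/
def k4eSrc : Fin 5 → Fin 4 := ![0, 0, 0, 1, 1]

/-- the targets of `K₄ − e`. [cite: King1986, p.664] -/
def k4eTgt : Fin 5 → Fin 4 := ![1, 2, 3, 2, 3]

/-- `K₄ − e` is connected to its external vertex. [folklore] -/
theorem lConn_k4e : ∀ v : Fin 4, LConn k4eSrc k4eTgt univ 0 v := by
  intro v
  fin_cases v
  · exact Relation.EqvGen.refl _
  · exact Relation.EqvGen.rel _ _ ⟨0, mem_univ _, rfl, rfl⟩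
  · exact Relation.EqvGen.rel _ _ ⟨1, mem_univ _, rfl, rfl⟩
  · exact Relation.EqvGen.rel _ _ ⟨2, mem_univ _, rfl, rfl⟩

/-- **IN FOUR DIMENSIONS `K₄ − e` IS SPARSE** (`d = 3`: `2|S| + 5 ≤ 4|V(S)|` for all 31 non-empty line sets; the whole graph: `15 ≤ 16`, degree `2`).
[cite: King1986, p.664] -/
theorem sparseCert_k4e_three :
    ∀ S : Finset (Fin 5), S.Nonempty → (3 - 1) * S.card + 3 + 2 ≤ (3 + 1) * (lineVerts k4eSrc k4eTgt S).card := by decide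

end Cert

end Summit.QuantumFields.YangMills.BalabanUVNodes.N15KingModelRung.Graph

namespace Summit.QuantumFields.YangMills.BalabanUVNodes.N15KingModelRung.Curved

open scoped BigOperators
open Finset
open Literature.MathematicalPhysics.QuantumFieldTheory.Balaban1983to89.B5Prop11Plancherel (Tor fine unitVec)
open Summit.QuantumFields.YangMills.BalabanUVNodes.N15KingModelRung (KingVolIndex kingVol kingVol_neZero)
open Summit.QuantumFields.YangMills.BalabanUVNodes.N15KingModelRung.Graph

variable {d : ℕ} (L : ℕ) [NeZero L]

/-! ## §2 Proposition 3.6 (3.56) from the certificate; the bubble; `K₄ − e` -/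

section Prop36Cert

/-- ★★★ **KING 1986 PROPOSITION 3.6 (3.56) FROM THE DECIDABLE CERTIFICATE**: for `1 ≤ d`, every connected numbered graph of `G`-lines whose non-empty line sets
satisfy `(d−1)·|S| + d + 2 ≤ (d+1)·|V(S)|` obeys
(3.56) with the constants of part Δ-d `king_prop36_graph_zeroField_sparse` — no hypothesis on degrees, orderings or margins; for explicit graphs the certificate is
`decide`d. [cite: King1986, Prop. 3.6 (3.56) p.662, p.664] -/
theorem king_prop36_graph_zeroField_sparseCert (hd1 : 1 ≤ d) (hLodd : Odd L) (hL : 2 ≤ L) {a : ℝ} (ha : 0 < a) {m0sq : ℝ} (hm0 : 0 ≤ m0sq) :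
    ∃ C₁ C₂ γ₀ : ℝ, 0 < C₁ ∧ 0 < C₂ ∧ 0 < γ₀ ∧ ∀ (msq : ℝ), 0 < msq → msq ≤ m0sq → ∀ (jv : KingVolIndex d) (n : ℕ), 1 ≤ n →
      ∀ (nn m : ℕ) (src tgt : Fin m → Fin (nn + 1)), (∀ v, LConn src tgt univ 0 v) →
      (∀ S : Finset (Fin m), S.Nonempty → (d - 1) * S.card + d + 2 ≤ (d + 1) * (lineVerts src tgt S).card) →
      ∀ (Υ : Type) [Fintype Υ] [DecidableEq Υ]
        (vtx : Υ → Fin (nn + 1)) (υ₀ : Υ), vtx υ₀ = 0 →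
        haveI := kingVol_neZero L jv
        ∀ (u : Υ → Tor (fine (L ^ jv.K) (kingVol L jv)) → ℝ) (u' : Υ → Tor (fine (L ^ (jv.K + n)) (kingVol L jv)) → ℝ)
          (qq s : Υ → ℝ) (p₀ r₀ : Tor (fine (L ^ jv.K) (kingVol L jv)) → ℝ) (Γ Γ' : ℝ),
          (∀ υ, 0 ≤ qq υ) → (∀ υ, 0 ≤ s υ) → (∀ x, 0 ≤ r₀ x) →
          (∀ υ, υ ≠ υ₀ → ∀ x, |u υ x| ≤ qq υ) → (∀ υ, υ ≠ υ₀ → ∀ x', |u' υ x'| ≤ qq υ) →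
          (∀ υ, υ ≠ υ₀ → ∀ x', |u' υ x' - u υ (kingSlicePt L jv.K n (kingVol L jv) x')| ≤ s υ * qq υ) →
          (∀ x, |u υ₀ x| ≤ p₀ x) → (∀ x', |u' υ₀ x'| ≤ p₀ (kingSlicePt L jv.K n (kingVol L jv) x')) →
          (∀ x', |u' υ₀ x' - u υ₀ (kingSlicePt L jv.K n (kingVol L jv) x')| ≤ r₀ (kingSlicePt L jv.K n (kingVol L jv) x')) →
          (∑ x, (((L : ℝ) ^ jv.K)⁻¹) ^ (d + 1) * p₀ x ≤ Γ) → (∑ x, (((L : ℝ) ^ jv.K)⁻¹) ^ (d + 1) * r₀ x ≤ Γ') →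
            |graphValLS ((((L : ℝ) ^ (jv.K + n))⁻¹) ^ (d + 1)) src tgt (fun _ => kingGLine L (kingVol L jv) a msq (jv.K + n) none) vtx u'
                - graphValLS ((((L : ℝ) ^ jv.K)⁻¹) ^ (d + 1)) src tgt (fun _ => kingGLine L (kingVol L jv) a msq jv.K none) vtx u|
              ≤ (Γ' + Γ * ((L : ℝ) ^ (-(min γ₀ (1 / 4) * jv.K)) * (m + 1) + ∑ υ ∈ univ.erase υ₀, s υ))
                * (C₁ ^ m * C₂ ^ nn * ((m.factorial : ℝ) * ((1 - (L : ℝ) ^ (-(1 / 4 : ℝ)))⁻¹) ^ m) * ∏ υ ∈ univ.erase υ₀, qq υ) := by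
  obtain ⟨C₁, C₂, γ₀, hC₁, hC₂, hγ₀, H⟩ := king_prop36_graph_zeroField_sparse (d := d) L hLodd hL ha hm0
  refine ⟨C₁, C₂, γ₀, hC₁, hC₂, hγ₀, fun msq hm hcap jv n hn nn m src tgt hconn hcert Υ _ _ vtx υ₀ hυ₀ u u' qq s p₀ r₀ Γ Γ'
    hqq hs hr₀ hu hu' hus hp₀ hp₀' hr₀' hΓ hΓ' => ?_⟩
  exact H msq hm hcap jv n hn nn m src tgt hconn (fun S hS _ => sparse_of_sparseCert hd1 hcert S hS) Υ vtx υ₀ hυ₀ u u' qq s p₀ r₀ Γ Γ'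
    hqq hs hr₀ hu hu' hus hp₀ hp₀' hr₀' hΓ hΓ'

/-- ★★ **THE ONE-LOOP BUBBLE IN KING's THREE DIMENSIONS OBEYS (3.56) OUTRIGHT** (`d = 2`): two parallel `G`-lines between the external vertex `0` and one internal
vertex — a loop AND a parallel pair, degree `3·1 − 2 = 1 > 0` — with no renormalisation and no hypothesis. [cite: King1986, Prop. 3.6 (3.56) p.662, p.664] -/
theorem king_prop36_graph_zeroField_bubble (hLodd : Odd L) (hL : 2 ≤ L) {a : ℝ} (ha : 0 < a) {m0sq : ℝ} (hm0 : 0 ≤ m0sq) :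
    ∃ C₁ C₂ γ₀ : ℝ, 0 < C₁ ∧ 0 < C₂ ∧ 0 < γ₀ ∧ ∀ (msq : ℝ), 0 < msq → msq ≤ m0sq → ∀ (jv : KingVolIndex 2) (n : ℕ), 1 ≤ n →
      ∀ (Υ : Type) [Fintype Υ] [DecidableEq Υ]
        (vtx : Υ → Fin (1 + 1)) (υ₀ : Υ), vtx υ₀ = 0 →
        haveI := kingVol_neZero L jv
        ∀ (u : Υ → Tor (fine (L ^ jv.K) (kingVol L jv)) → ℝ) (u' : Υ → Tor (fine (L ^ (jv.K + n)) (kingVol L jv)) → ℝ)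
          (qq s : Υ → ℝ) (p₀ r₀ : Tor (fine (L ^ jv.K) (kingVol L jv)) → ℝ) (Γ Γ' : ℝ),
          (∀ υ, 0 ≤ qq υ) → (∀ υ, 0 ≤ s υ) → (∀ x, 0 ≤ r₀ x) →
          (∀ υ, υ ≠ υ₀ → ∀ x, |u υ x| ≤ qq υ) → (∀ υ, υ ≠ υ₀ → ∀ x', |u' υ x'| ≤ qq υ) →
          (∀ υ, υ ≠ υ₀ → ∀ x', |u' υ x' - u υ (kingSlicePt L jv.K n (kingVol L jv) x')| ≤ s υ * qq υ) →
          (∀ x, |u υ₀ x| ≤ p₀ x) → (∀ x', |u' υ₀ x'| ≤ p₀ (kingSlicePt L jv.K n (kingVol L jv) x')) →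
          (∀ x', |u' υ₀ x' - u υ₀ (kingSlicePt L jv.K n (kingVol L jv) x')| ≤ r₀ (kingSlicePt L jv.K n (kingVol L jv) x')) →
          (∑ x, (((L : ℝ) ^ jv.K)⁻¹) ^ (2 + 1) * p₀ x ≤ Γ) → (∑ x, (((L : ℝ) ^ jv.K)⁻¹) ^ (2 + 1) * r₀ x ≤ Γ') →
            |graphValLS ((((L : ℝ) ^ (jv.K + n))⁻¹) ^ (2 + 1)) bubSrc bubTgt (fun _ => kingGLine L (kingVol L jv) a msq (jv.K + n) none) vtx u'
                - graphValLS ((((L : ℝ) ^ jv.K)⁻¹) ^ (2 + 1)) bubSrc bubTgt (fun _ => kingGLine L (kingVol L jv) a msq jv.K none) vtx u|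
              ≤ (Γ' + Γ * ((L : ℝ) ^ (-(min γ₀ (1 / 4) * jv.K)) * (((2 : ℕ) : ℝ) + 1) + ∑ υ ∈ univ.erase υ₀, s υ))
                * (C₁ ^ 2 * C₂ ^ 1 * (((Nat.factorial 2 : ℕ) : ℝ) * ((1 - (L : ℝ) ^ (-(1 / 4 : ℝ)))⁻¹) ^ 2) * ∏ υ ∈ univ.erase υ₀, qq υ) := by
  obtain ⟨C₁, C₂, γ₀, hC₁, hC₂, hγ₀, H⟩ := king_prop36_graph_zeroField_sparseCert (d := 2) L (by norm_num) hLodd hL ha hm0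
  refine ⟨C₁, C₂, γ₀, hC₁, hC₂, hγ₀, fun msq hm hcap jv n hn Υ _ _ vtx υ₀ hυ₀ u u' qq s p₀ r₀ Γ Γ'
    hqq hs hr₀ hu hu' hus hp₀ hp₀' hr₀' hΓ hΓ' => ?_⟩
  exact H msq hm hcap jv n hn 1 2 bubSrc bubTgt lConn_bubble sparseCert_bubble_two Υ vtx υ₀ hυ₀ u u' qq s p₀ r₀ Γ Γ'
    hqq hs hr₀ hu hu' hus hp₀ hp₀' hr₀' hΓ hΓ'

/-- ★★ **`K₄ − e` IN FOUR DIMENSIONS OBEYS (3.56) OUTRIGHT** (`d = 3`): five `G`-lines `01, 02, 03, 12, 13` — TWO independent loops — degree `4·3 − 2·5 = 2`, every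
sub-line-set positive (by `decide`), no hypothesis. [cite: King1986, Prop. 3.6 (3.56) p.662, p.664] -/
theorem king_prop36_graph_zeroField_k4e (hLodd : Odd L) (hL : 2 ≤ L) {a : ℝ} (ha : 0 < a) {m0sq : ℝ} (hm0 : 0 ≤ m0sq) :
    ∃ C₁ C₂ γ₀ : ℝ, 0 < C₁ ∧ 0 < C₂ ∧ 0 < γ₀ ∧ ∀ (msq : ℝ), 0 < msq → msq ≤ m0sq → ∀ (jv : KingVolIndex 3) (n : ℕ), 1 ≤ n →
      ∀ (Υ : Type) [Fintype Υ] [DecidableEq Υ]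
        (vtx : Υ → Fin (3 + 1)) (υ₀ : Υ), vtx υ₀ = 0 →
        haveI := kingVol_neZero L jv
        ∀ (u : Υ → Tor (fine (L ^ jv.K) (kingVol L jv)) → ℝ) (u' : Υ → Tor (fine (L ^ (jv.K + n)) (kingVol L jv)) → ℝ)
          (qq s : Υ → ℝ) (p₀ r₀ : Tor (fine (L ^ jv.K) (kingVol L jv)) → ℝ) (Γ Γ' : ℝ),
          (∀ υ, 0 ≤ qq υ) → (∀ υ, 0 ≤ s υ) → (∀ x, 0 ≤ r₀ x) →
          (∀ υ, υ ≠ υ₀ → ∀ x, |u υ x| ≤ qq υ) → (∀ υ, υ ≠ υ₀ → ∀ x', |u' υ x'| ≤ qq υ) →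
          (∀ υ, υ ≠ υ₀ → ∀ x', |u' υ x' - u υ (kingSlicePt L jv.K n (kingVol L jv) x')| ≤ s υ * qq υ) →
          (∀ x, |u υ₀ x| ≤ p₀ x) → (∀ x', |u' υ₀ x'| ≤ p₀ (kingSlicePt L jv.K n (kingVol L jv) x')) →
          (∀ x', |u' υ₀ x' - u υ₀ (kingSlicePt L jv.K n (kingVol L jv) x')| ≤ r₀ (kingSlicePt L jv.K n (kingVol L jv) x')) →
          (∑ x, (((L : ℝ) ^ jv.K)⁻¹) ^ (3 + 1) * p₀ x ≤ Γ) → (∑ x, (((L : ℝ) ^ jv.K)⁻¹) ^ (3 + 1) * r₀ x ≤ Γ') →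
            |graphValLS ((((L : ℝ) ^ (jv.K + n))⁻¹) ^ (3 + 1)) k4eSrc k4eTgt (fun _ => kingGLine L (kingVol L jv) a msq (jv.K + n) none) vtx u'
                - graphValLS ((((L : ℝ) ^ jv.K)⁻¹) ^ (3 + 1)) k4eSrc k4eTgt (fun _ => kingGLine L (kingVol L jv) a msq jv.K none) vtx u|
              ≤ (Γ' + Γ * ((L : ℝ) ^ (-(min γ₀ (1 / 4) * jv.K)) * (((5 : ℕ) : ℝ) + 1) + ∑ υ ∈ univ.erase υ₀, s υ))
                * (C₁ ^ 5 * C₂ ^ 3 * (((Nat.factorial 5 : ℕ) : ℝ) * ((1 - (L : ℝ) ^ (-(1 / 4 : ℝ)))⁻¹) ^ 5) * ∏ υ ∈ univ.erase υ₀, qq υ) := by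
  obtain ⟨C₁, C₂, γ₀, hC₁, hC₂, hγ₀, H⟩ := king_prop36_graph_zeroField_sparseCert (d := 3) L (by norm_num) hLodd hL ha hm0
  refine ⟨C₁, C₂, γ₀, hC₁, hC₂, hγ₀, fun msq hm hcap jv n hn Υ _ _ vtx υ₀ hυ₀ u u' qq s p₀ r₀ Γ Γ'
    hqq hs hr₀ hu hu' hus hp₀ hp₀' hr₀' hΓ hΓ' => ?_⟩
  exact H msq hm hcap jv n hn 3 5 k4eSrc k4eTgt lConn_k4e sparseCert_k4e_three Υ vtx υ₀ hυ₀ u u' qq s p₀ r₀ Γ Γ'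
    hqq hs hr₀ hu hu' hus hp₀ hp₀' hr₀' hΓ hΓ'

end Prop36Cert

end Summit.QuantumFields.YangMills.BalabanUVNodes.N15KingModelRung.Curved

end
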